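import Literature.MathematicalPhysics.QuantumFieldTheory.Balaban1983to89.B8Eq142KLevelLocalGammaRec
import Literature.MathematicalPhysics.QuantumFieldTheory.Balaban1983to89.B8Eq156KLevelLocalRec
import Literature.MathematicalPhysics.QuantumFieldTheory.Balaban1983to89.B8Thm4SupportLocalBdryRec
import Literature.MathematicalPhysics.QuantumFieldTheory.Balaban1983to89.B8Eq138LandauZdRec
import Literature.MathematicalPhysics.QuantumFieldTheory.Balaban1983to89.B8Thm4KLevelGamma

/-!
# `Balaban1983to89.B8Thm4KLevelGammaRec` — RECORD TWIN of `B8Thm4KLevelGamma` ([Balaban1985RegularSpaces] THEOREM 4 p. 88 «on Λ_j, j = 0, 1, …, k», the existence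
# clause at all levels with the support invariant, edition γ = print's box law «box ⊂ Ω_{j−1}» of (1.31)) FOR THE SYMMETRISED CENTRED block averaging (0.4) of
# [Balaban1987RG1], with the RECORD's Prop-4 regime (director-ym №267: «(128)∕(130)∕(131) hold for the record k-uniformly with constants ×(1+4dL)»)

statement-level skeleton of published theorems with citation tags; proofs where landed; nothing here is a claim about the Yang–Mills mass gap

T. Bałaban, *Spaces of regular gauge field configurations on a lattice and gauge fixing conditions*, Commun. Math. Phys. **99** (1985) 75–102 `[Balaban1985RegularSpaces]`
("[6]"): Thm 4 p. 88, (1.29) p. 81, (1.31) p. 82, (1.38) p. 82, (1.41)–(1.42) p. 83, (1.55)–(1.62) pp. 86–87, (1.66) p. 87, Prop. 3 p. 87, Prop. 5 (1.107)–(1.108) p. 94;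
T. Bałaban, *Averaging operations for lattice gauge theories*, Commun. Math. Phys. **98** (1985) 17–51 `[Balaban1985Averaging]` ("[3]"): Prop. 4 p. 38; T. Bałaban,
*Renormalization group approach to lattice gauge field theories. I*, Commun. Math. Phys. **109** (1987) 249–301 `[Balaban1987RG1]` ("[I]"): (0.3)–(0.4) pp. 252–253.

CITATION HEADER (lean-in-tree rule).  Cell `pub-ymgap`, «N05-REC» stage 2 (director-ym №254∕№255∕№265∕№267∕№288), item R5 sub-chain α-§2, file 1 — typed by the LEAD
PEN dag-n05-e g38 on dag-n05-c's recipe (inventory `N05-REC-INVENTORY.md` §R5 row `B8Thm4KLevelGamma`: class A = `norm_B1_lt_kLevel_γ thm4_exists_all_levels_supp_landau138_γ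
hP3_gaugeFixed_of_b9_γ`).  WHAT IS REPRODUCED = ✓ the engine module over the record inputs: §0 over dag-n05-e's `B8Eq156KLevelLocalRec.norm_B1_lt_loc` (CENTRED bond box
`[Lʲc₋ − c_j𝟙, Lʲc₋ + Lʲe_κ + c_j𝟙]`, [I] (0.3)); §1 verbatim with `linCovIter ∕ logCovIter ∕ Restr129 ↦ linCovIterZ ∕ logCovIterZ ∕ Restr129Z` (the class-0 engines
`B8Eq155KLevelLocal.eq155_norm_kLevel_hermitian`, `B8Prop3KLevelBdry.apriori_160_bdry ∕ apriori_162_bdry`, `B8ScaledSupNorm`, `logField_spec` BY NAME); §2 over dag-n05-c's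
record driver `B8Thm4SupportLocalBdryRec.thm4_exists_all_levels_supp_bdry` and `B8Eq142KLevelLocalGammaRec.H42_of_inAx_γ` (`IsLandau138W ↦ IsLandau138WZ`, `InAx ↦ InAxZ`,
`avgIter ↦ avgIterZ`, corner boxes∕blocks ↦ CENTRED).  WINDOWS: the engine's Prop-4 regime one level lower ↦ the record's at `(L²α₀, Lα₂)`: odd `L = 2s+1`, `1 ≤ s`,
`C0Z·L²α₀ ≤ 1∕3`, `4L²α₀ ≤ c₂′`, `e^{4cZ·L²α₀}(1 + 2C₁KZ²·Lα₂) ≤ 2`, `KZ·Lα₂ ≤ c₃`; the (1.56) remainder constant becomes `C₂ ≥ (1+2gZ)·2C₁·KZ²·e^{4cZ·L²α₀}·L²`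
(`C₁ = 131072(d+1)²`; `cZ ∕ gZ ∕ KZ` of `B7Prop4GeneralLevelsRec`); the engine's idle `h16γ` is dropped.  Declaration names = engine names (T5).  Kind «kernel-checked proof»,
theorems only; no `def`, no `instance`, no `notation`, no existing module modified.  `--supports stmt-QuantumFields-20541` (K0⁷-keyed, COUNT-NEUTRAL).

HONEST SCOPE: Theorem 4's existence clause for the record's centred averaging MODULO its displayed sockets (`hP5base`, `hP5` = Prop. 5 ∕ Sect. E; `H59Dβ` = the β-shaped
(1.59) clause; `hlay`, `hclass`, `hbox` = the family's geometry); nothing of Bałaban's analysis re-proved; `HThm4Rec` UNDISCHARGED; caveat (C-S3-1) + addendum v4 stand;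
N05 [B8] DISCHARGED OF RECORD untouched; COUNT of record unmoved · K numerically unchanged; one finite `𝕋⁴` programme at fixed `ε`, Bałaban AS PRINTED; nothing continuum ∕ ℝ⁴ ∕
OS ∕ mass-gap ∕ Clay.  No `sorry`, no `def`.

[cite: Balaban1985RegularSpaces, Thm 4 p.88, Prop. 3 p.87, (1.55)–(1.62) pp.86–87, (1.31) p.82, (1.29) p.81; Balaban1985Averaging, Prop. 4 p.38; Balaban1987RG1, (0.3)–(0.4) pp.252–253]
-/

noncomputable section

open NormedSpace

namespace Literature.MathematicalPhysics.QuantumFieldTheory.Balaban1983to89.B8Thm4KLevelGammaRec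

open Complex (I I_ne_zero)
open MatrixLog B7Prop1Explicit B7Prop2Explicit B7Prop1Local B7Eq92Concrete
open B8Lemma1NonAbelian (mulCfg)
open B8Ineq132 (covDerivFwd covDeriv covDiv plaqF InAk CondAt BondTouches PlaqTouches)
open B8Eq140Level (SideTouches)
open B8Eq119TwistedAxialRec (Restr129Z InAxZ)
open B8Eq184Proof (gaugeExp cfgExp)
open B8Eq146AExpansion (iEta expCfg)
open B7SectEFLinearisationRec (logCovIterZ linCovIterZ)
open BlockAveragingZd (avgIterZ ctrShift)
open B7Prop2Rec (AvgClosedZ C0Z avgClosedZ_unitaryUnits)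
open B7Prop4GeneralLevelsRec (cZ gZ KZ)
open B8Lemma1NonAbelianRecLoops (halfVec)
open B8Eq155JBound (Jcur wsup)
open B8ScaledSupNorm (bondNorm msup weight Bdd)
open B7Prop3Flat (c3)
open B7Eq78Linearization (conjR)
open B8Eq138LandauZdRec (IsLandau138WZ)
open B8Prop3GaugeFixedKLevel (mem_unitaryUnits_of_mgauge_eq mulCfg_eq_gaugeAct_of_mgauge_eq inAk_congr_of_sideTouches
  expCfg_iEta_eq_cfgExp cfgExp_congr_at logField_spec)
open B9SupplySockB9P3ZdBeta (CrossB)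


-- `Site` alone could resolve to the torus sites of `Setup.lean`; re-export the `ℤ^d` sites of `B7Prop1Explicit`.
export B7Prop1Explicit (Site)

variable {d : ℕ}

variable {𝔸 : Type*} [CStarAlgebra 𝔸] [Nontrivial 𝔸]

/-! ## §0 (1.56) at a datum bond under print's box law -/

/-- ★ **«|B₁| < 2dLα₁ + C₂α₂²» AT A DATUM BOND WHOSE BOX LIES IN `Ω_{j−1}`** — dag-n05-a's `B8Eq156KLevelLocal.norm_B1_lt_kLevel` under the γ law: the
plaquettes ((1.7), `h40`) and the exponent ((1.41), `h41`) are read on the bond's box at level `j − 1`, i.e. `norm_B1_lt_loc` is applied at `(L²α₀, L·α₂)`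
(`α₀(Lʲ⁻¹)⁻² ≤ L²α₀(Lʲ)⁻²`, `α₂(Lʲ⁻¹η)⁻¹ ≤ Lα₂(Lʲη)⁻¹`); remainder constant `8·131072(d+1)²·e^{…L²α₀}·L²`.
[cite: Balaban1985RegularSpaces, p.86 (sentence after (1.56)), (1.31) p.82, (1.41)–(1.42) p.83; Balaban1985Averaging, Prop. 4 p.36] -/
theorem norm_B1_lt_kLevel_γ {η : ℝ} (hη : 0 < η) {L s : ℕ} (hLs : L = 2 * s + 1) (hs : 1 ≤ s) (hd : 1 ≤ d) {G : Subgroup 𝔸ˣ} (hG : AvgClosedZ d L G) {k : ℕ}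
    (U₀ : Site d → Fin d → 𝔸ˣ) (hU₀ : ∀ x κ, U₀ x κ ∈ G) {α₀ : ℝ} (hα₀ : 0 < α₀)
    (hα3 : C0Z d * ((L : ℝ) ^ 2 * α₀) ≤ 1 / 3) (hα4 : 4 * ((L : ℝ) ^ 2 * α₀) ≤ c2' d L) (A : Site d → Fin d → 𝔸) {α₂ : ℝ} (hα₂ : 0 ≤ α₂)
    (hsmall : Real.exp (4 * cZ d * ((L : ℝ) ^ 2 * α₀)) * (1 + 2 * (131072 * ((d : ℝ) + 1) ^ 2) * (KZ d L) ^ 2 * ((L : ℝ) * α₂)) ≤ 2)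
    (hc₃ : KZ d L * ((L : ℝ) * α₂) ≤ c3 d L) {Ω : ℕ → Set (Site d)} {Λ : ℕ → Set (Site d × Fin d)}
    (hbox : ∀ j, j ≤ k → ∀ c ∈ Λ j, ∀ x, InBox (fun i => (L : ℤ) ^ j * c.1 i - (ctrShift L j : ℤ)) (fun i => (L : ℤ) ^ j * c.1 i + (ctrShift L j : ℤ) + if i = c.2 then (L : ℤ) ^ j else 0) x → x ∈ Ω (j - 1))
    (h40 : InAk L k η α₀ Ω U₀)
    (h41 : ∀ j, j ≤ k → ∀ x μ, BondTouches (Ω j) x μ → ‖A x μ‖ ≤ α₂ * ((L : ℝ) ^ j * η)⁻¹)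
    {α₁ : ℝ} (h42 : ∀ j, j ≤ k → ∀ c ∈ Λ j, ‖logCovIterZ L U₀ (iEta η A) j c.1 c.2‖ < 2 * d * L * α₁)
    {j : ℕ} (hj : j ≤ k) {c : Site d × Fin d} (hc : c ∈ Λ j) :
    ‖linCovIterZ L U₀ (iEta η A) j c.1 c.2‖
      < 2 * d * L * α₁ + (1 + 2 * gZ d L) * (2 * (131072 * ((d : ℝ) + 1) ^ 2) * (KZ d L) ^ 2)
          * Real.exp (4 * cZ d * ((L : ℝ) ^ 2 * α₀)) * (L : ℝ) ^ 2 * α₂ ^ 2 := by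
  have hL1 : 1 ≤ L := by omega
  have hLr : (1 : ℝ) ≤ L := by exact_mod_cast hL1
  have hLpos : (0 : ℝ) < L := by exact_mod_cast (show 0 < L by omega)
  have hjm1 : j - 1 ≤ k := (Nat.sub_le j 1).trans hj
  -- the two scale factors
  have hpow1 : ((L : ℝ) ^ (j - 1))⁻¹ ≤ (L : ℝ) * ((L : ℝ) ^ j)⁻¹ := by
    rcases Nat.eq_zero_or_pos j with rfl | hjp
    · simp only [Nat.zero_sub, pow_zero, inv_one, mul_one]; exact hLr
    · obtain ⟨i, rfl⟩ : ∃ i, j = i + 1 := ⟨j - 1, by omega⟩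
      rw [Nat.add_sub_cancel, pow_succ, mul_inv, ← mul_assoc, mul_comm (L : ℝ), mul_assoc, mul_inv_cancel₀ hLpos.ne', mul_one]
  have hpow2 : (((L : ℝ) ^ (j - 1))⁻¹) ^ 2 ≤ (L : ℝ) ^ 2 * (((L : ℝ) ^ j)⁻¹) ^ 2 := by
    have h := mul_self_le_mul_self (by positivity) hpow1
    nlinarith [h]
  have hscale : α₀ * (((L : ℝ) ^ (j - 1))⁻¹) ^ 2 ≤ (L : ℝ) ^ 2 * α₀ * (((L : ℝ) ^ j)⁻¹) ^ 2 := by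
    have := mul_le_mul_of_nonneg_left hpow2 hα₀.le
    linarith [this]
  have hscale1 : α₂ * ((L : ℝ) ^ (j - 1) * η)⁻¹ ≤ (L : ℝ) * α₂ * ((L : ℝ) ^ j * η)⁻¹ := by
    rw [mul_inv, mul_inv]
    have := mul_le_mul_of_nonneg_left hpow1 (mul_nonneg hα₂ (inv_nonneg.mpr hη.le))
    nlinarith [this, inv_nonneg.mpr hη.le, hα₂]
  have hα₀' : 0 < (L : ℝ) ^ 2 * α₀ := by positivity
  have h := B8Eq156KLevelLocalRec.norm_B1_lt_loc hη hLs hs hd hG j U₀ hU₀ hα₀' hα3 hα4 c.1 c.2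
    (fun x μ ν hμν hp => ((h40 (j - 1) hjm1).1 x μ ν hμν (Or.inl (hbox j hj c hc x hp.1))).trans_le hscale) A
    (by positivity : 0 ≤ (L : ℝ) * α₂)
    (fun x μ hb => (h41 (j - 1) hjm1 x μ (Or.inl (hbox j hj c hc x hb.1))).trans hscale1)
    hsmall hc₃ (h42 j hj c hc)
  calc ‖linCovIterZ L U₀ (iEta η A) j c.1 c.2‖
      < 2 * d * L * α₁ + (1 + 2 * gZ d L) * (2 * (131072 * ((d : ℝ) + 1) ^ 2) * (KZ d L) ^ 2)
          * Real.exp (4 * cZ d * ((L : ℝ) ^ 2 * α₀)) * ((L : ℝ) * α₂) ^ 2 := h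
    _ = _ := by ring

#print axioms norm_B1_lt_kLevel_γ

/-! ## §1 Proposition 3's first member for the gauge-fixed fields, the (1.59) clause β-shaped over a parametric class, γ box law -/

/-- ★ **PROPOSITION 3's FIRST MEMBER FOR THE GAUGE-FIXED FIELDS OF THEOREM 4's INDUCTION, EDITION γ** — `B8Thm4KLevelBdryBeta.hP3_gaugeFixed_of_b9_bdryβ` with
the datum class `Λb` under print's law «box ⊂ Ω_{j−1}» (`hbox`), the (1.56) step through `norm_B1_lt_kLevel_γ` (windows at `(L²α₀, L·α₂)`, remainder constant
`C₂ ≥ 8·131072(d+1)²·e^{…L²α₀}·L²`); the (1.42) clause `H42` and the β-shaped two-line (1.59) socket `H59Dβ` over `Λb` are hypotheses as before.  Proof verbatim otherwise.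
[cite: Balaban1985RegularSpaces, Prop. 3 p.87, (1.55)–(1.62) pp.86–87, (1.31) p.82, Thm 4 p.88] -/
theorem hP3_gaugeFixed_of_b9_γ (hd2 : 2 ≤ d) {η : ℝ} (hη : 0 < η) {L s : ℕ} (hLs : L = 2 * s + 1) (hs : 1 ≤ s) (k : ℕ)
    {U₀ U' : Site d → Fin d → 𝔸ˣ} (hU₀ : ∀ x κ, U₀ x κ ∈ unitaryUnits 𝔸) (hU' : ∀ x κ, U' x κ ∈ unitaryUnits 𝔸)
    {α₀ α₁ α₄ B₀ cstar : ℝ} (hα₀ : 0 < α₀) (hα₁ : 0 ≤ α₁) (hα₄ : 0 ≤ α₄) (hB₀ : 0 ≤ B₀)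
    (hc : cstar = 5 * d * L * B₀ * (α₀ + α₁))
    -- [3] Prop. 4's linearisation windows ONE LEVEL LOWER (edition γ: the box of a level-`j` datum bond lies in `Ω_{j−1}`)
    (hα3 : C0Z d * ((L : ℝ) ^ 2 * α₀) ≤ 1 / 3) (hα4 : 4 * ((L : ℝ) ^ 2 * α₀) ≤ c2' d L)
    (h16 : 16 * (2 * (L * cstar) + 8 * α₄) ≤ 1) (hd5 : 5 * (2 * (L * cstar) + 8 * α₄) * ((d : ℝ) - 1) ≤ 4)
    (hsmall : Real.exp (4 * cZ d * ((L : ℝ) ^ 2 * α₀))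
      * (1 + 2 * (131072 * ((d : ℝ) + 1) ^ 2) * (KZ d L) ^ 2 * ((L : ℝ) * (2 * (L * cstar) + 8 * α₄))) ≤ 2)
    (hc₃ : KZ d L * ((L : ℝ) * (2 * (L * cstar) + 8 * α₄)) ≤ c3 d L) (hside : 36 * d * B₀ * (2 * (L * cstar) + 8 * α₄) ≤ 1 / 2)
    (h50 : 50 * d * (2 * (L * cstar) + 8 * α₄) ≤ 1)
    {C₂ : ℝ} (hC₂ : (1 + 2 * gZ d L) * (2 * (131072 * ((d : ℝ) + 1) ^ 2) * (KZ d L) ^ 2) * Real.exp (4 * cZ d * ((L : ℝ) ^ 2 * α₀)) * (L : ℝ) ^ 2 ≤ C₂)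
    (h61 : 2 * (2 * (L * cstar) + 8 * α₄) ^ 2 + 20 * d * α₀ * (2 * (L * cstar) + 8 * α₄)
      + 2 * C₂ * (2 * (L * cstar) + 8 * α₄) ^ 2 ≤ α₀ + α₁)
    {Bbd a : ℝ} (hBbd : 0 ≤ Bbd) (ha0 : 0 ≤ a) (ha : a ≤ 1 / 4) (hbdry : 4 * Bbd * a ≤ ((d : ℝ) * L - 1) * B₀ * (α₀ + α₁))
    (Ω : ℕ → Set (Site d)) (Λs : ℕ → ℕ → Set (Site d)) (Λb : ℕ → ℕ → Set (Site d × Fin d))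
    -- PRINT's box law (edition γ): the locality box of a level-`j` datum bond lies in `Ω_{j−1}` ((1.31); level 0: `Ω₀`)
    (hbox : ∀ m, m ≤ k → ∀ j, j ≤ m → ∀ c ∈ Λb m j, ∀ x, InBox (fun i => (L : ℤ) ^ j * c.1 i - (ctrShift L j : ℤ)) (fun i => (L : ℤ) ^ j * c.1 i + (ctrShift L j : ℤ) + if i = c.2 then (L : ℤ) ^ j else 0) x → x ∈ Ω (j - 1))
    (h33 : InAk L k η α₀ Ω U₀) (h34 : InAk L k η α₀ Ω (mulCfg U' U₀))
    (h66 : ∀ b ∈ {b : Site d × Fin d | SideTouches (Ω 0) b.1 b.2}, ‖((U' b.1 b.2 : 𝔸ˣ) : 𝔸) - 1‖ ≤ a)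
    (hlay : ∀ m, 1 ≤ m → m ≤ k → ∀ y z : Site d, y ∈ Ω 0 → z ∉ Ω 0 → (∀ i, y i - 1 ≤ z i ∧ z i ≤ y i + 1) → y ∈ Λs m 0)
    (haα : a ≤ (d : ℝ) * L * α₁)
    (Lan : ℕ → (Site d → Fin d → 𝔸ˣ) → Prop)
    (H42 : ∀ m, 1 ≤ m → m ≤ k → ∀ (u : Site d → 𝔸ˣ) (W : Site d → Fin d → 𝔸ˣ) (A' : Site d → Fin d → 𝔸),
      (∀ x, u x ∈ unitaryUnits 𝔸) → mgauge U₀ u W = U' → Restr129Z L m (Λs m) U₀ u → Lan m W →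
      (∀ y τ, IsSelfAdjoint (A' y τ)) →
      (∀ j, j ≤ m → ∀ y τ, SideTouches (Ω j) y τ →
        W y τ = cfgExp η A' y τ ∧ ‖A' y τ‖ ≤ (2 * (L * cstar) + 8 * α₄) * ((L : ℝ) ^ j * η)⁻¹) →
      (∀ y τ, (∀ j, j ≤ m → ¬ SideTouches (Ω j) y τ) → A' y τ = 0) →
      ∀ j, j ≤ m → ∀ c ∈ Λb m j, ‖logCovIterZ L U₀ (iEta η A') j c.1 c.2‖ < 2 * d * L * α₁)
    (H59Dβ : ∀ m, 1 ≤ m → m ≤ k → ∀ (u : Site d → 𝔸ˣ) (W : Site d → Fin d → 𝔸ˣ) (A' : Site d → Fin d → 𝔸),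
      (∀ x, u x ∈ unitaryUnits 𝔸) → (∀ x, x ∉ Ω 0 → u x = 1) → mgauge U₀ u W = U' → Restr129Z L m (Λs m) U₀ u → Lan m W →
      (∀ y τ, IsSelfAdjoint (A' y τ)) →
      (∀ j, j ≤ m → ∀ y τ, SideTouches (Ω j) y τ →
        W y τ = cfgExp η A' y τ ∧ ‖A' y τ‖ ≤ (2 * (L * cstar) + 8 * α₄) * ((L : ℝ) ^ j * η)⁻¹) →
      (∀ y τ, (∀ j, j ≤ m → ¬ SideTouches (Ω j) y τ) → A' y τ = 0) →
      msup L m η (-(1 : ℝ)) (fun j (b : Site d × Fin d) => SideTouches (Ω j) b.1 b.2) (fun b => A' b.1 b.2)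
          ≤ B₀ * (bondNorm L m η (-(3 : ℝ)) Ω (fun x μ => Jcur η U₀ A' μ x)
            + wsup 1 (fun p : {p : ℕ × (Site d × Fin d) // p.1 ≤ m ∧ (p.2 ∈ Λb m p.1 ∨ (p.1 = 0 ∧ CrossB (Ω 0) p.2))} =>
                linCovIterZ L U₀ (iEta η A') p.1.1 p.1.2.1 p.1.2.2))
            + Bbd * msup L m η (-(1 : ℝ)) (fun j (b : Site d × Fin d) => j = 0 ∧ SideTouches (Ω 0) b.1 b.2 ∧ ¬ BondTouches (Ω 0) b.1 b.2)
                (fun b => A' b.1 b.2) ∧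
        msup L m η (-(2 : ℝ)) (fun j (t : Fin d × Fin d × Site d) => SideTouches (Ω j) t.2.2 t.2.1)
            (fun t => covDerivFwd η U₀ t.1 (fun z => A' z t.2.1) t.2.2)
          ≤ B₀ * (bondNorm L m η (-(3 : ℝ)) Ω (fun x μ => Jcur η U₀ A' μ x)
            + wsup 1 (fun p : {p : ℕ × (Site d × Fin d) // p.1 ≤ m ∧ (p.2 ∈ Λb m p.1 ∨ (p.1 = 0 ∧ CrossB (Ω 0) p.2))} =>
                linCovIterZ L U₀ (iEta η A') p.1.1 p.1.2.1 p.1.2.2))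
            + Bbd * msup L m η (-(1 : ℝ)) (fun j (b : Site d × Fin d) => j = 0 ∧ SideTouches (Ω 0) b.1 b.2 ∧ ¬ BondTouches (Ω 0) b.1 b.2)
                (fun b => A' b.1 b.2)) :
    ∀ m, 1 ≤ m → m ≤ k → ∀ (u : Site d → 𝔸ˣ) (W : Site d → Fin d → 𝔸ˣ) (A : Site d → Fin d → 𝔸),
      (∀ x, u x ∈ unitaryUnits 𝔸) → (∀ x, x ∉ Ω 0 → u x = 1) → mgauge U₀ u W = U' → Restr129Z L m (Λs m) U₀ u → Lan m W →
      (∀ j, j ≤ m → ∀ b ∈ {b : Site d × Fin d | SideTouches (Ω j) b.1 b.2},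
        W b.1 b.2 = cfgExp η A b.1 b.2 ∧ ‖A b.1 b.2‖ ≤ (2 * (L * cstar) + 8 * α₄) * ((L : ℝ) ^ j * η)⁻¹) →
      ∀ j, j ≤ m → ∀ b ∈ {b : Site d × Fin d | SideTouches (Ω j) b.1 b.2},
        ‖A b.1 b.2‖ ≤ cstar * ((L : ℝ) ^ j * η)⁻¹ := by
  intro m hm1 hmk u W A hu huS hW h129 hLan hWA j₀ hj₀ b₀ hb₀
  have hL1 : 1 ≤ L := by omega
  have hLr : (1 : ℝ) ≤ L := by exact_mod_cast hL1
  set α₂ : ℝ := 2 * (L * cstar) + 8 * α₄ with hα₂_def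
  have hcstar : 0 ≤ cstar := by rw [hc]; positivity
  have hα₂ : 0 ≤ α₂ := by positivity
  have hα₂16 : α₂ ≤ 1 / 16 := by linarith
  -- `W` is unitary-valued
  have hWu : ∀ x κ, W x κ ∈ unitaryUnits 𝔸 := mem_unitaryUnits_of_mgauge_eq hU₀ hU' hu hW
  -- the bonds where the socket delivers `W = e^{iηA}`
  set M : Set (Site d × Fin d) := {b | ∃ j, j ≤ m ∧ SideTouches (Ω j) b.1 b.2} with hM_def
  -- the masked exponent field `A′ := (1/iη) log W` on `M`, `0` elsewhere
  set A' : Site d → Fin d → 𝔸 :=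
    fun y τ => M.indicator (fun b : Site d × Fin d => η⁻¹ • ((I⁻¹ : ℂ) • mlog ((W b.1 b.2 : 𝔸ˣ) : 𝔸))) (y, τ) with hA'_def
  -- on a socket bond: `A′ = A`, self-adjoint, `W = e^{iηA′}`
  have hsock : ∀ j, j ≤ m → ∀ y τ, SideTouches (Ω j) y τ →
      A' y τ = A y τ ∧ IsSelfAdjoint (A' y τ) ∧ W y τ = cfgExp η A' y τ := by
    intro j hj y τ hs
    have hmem : (y, τ) ∈ M := ⟨j, hj, hs⟩
    obtain ⟨hWA₁, hA₁⟩ := hWA j hj (y, τ) hs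
    have hLj : (1 : ℝ) ≤ (L : ℝ) ^ j := one_le_pow₀ hLr
    have hA₂ : ‖A y τ‖ ≤ α₂ * η⁻¹ := by
      calc ‖A y τ‖ ≤ α₂ * ((L : ℝ) ^ j * η)⁻¹ := hA₁
        _ = α₂ * η⁻¹ * ((L : ℝ) ^ j)⁻¹ := by rw [mul_inv]; ring
        _ ≤ α₂ * η⁻¹ * 1 := by
            apply mul_le_mul_of_nonneg_left (inv_le_one_of_one_le₀ hLj) (by positivity)
        _ = α₂ * η⁻¹ := mul_one _
    obtain ⟨hlog, hsa, hexp⟩ := logField_spec hη U₀ hWu hWA₁ hA₂ hα₂16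
    have hA'y : A' y τ = η⁻¹ • ((I⁻¹ : ℂ) • mlog ((W y τ : 𝔸ˣ) : 𝔸)) := by
      simp only [hA'_def, Set.indicator_of_mem hmem]
    refine ⟨by rw [hA'y, hlog], by rw [hA'y]; exact hsa, ?_⟩
    rw [hexp]
    exact cfgExp_congr_at η hA'y.symm
  have hA'0 : ∀ y τ, (∀ j, j ≤ m → ¬ SideTouches (Ω j) y τ) → A' y τ = 0 := by
    intro y τ h
    have hnot : (y, τ) ∉ M := fun ⟨j, hj, hs⟩ => h j hj hs
    simp only [hA'_def, Set.indicator_of_notMem hnot]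
  have hA'sa : ∀ y τ, IsSelfAdjoint (A' y τ) := by
    intro y τ
    by_cases hmem : (y, τ) ∈ M
    · obtain ⟨j, hj, hs⟩ := hmem
      exact (hsock j hj y τ hs).2.1
    · have : A' y τ = 0 := by simp only [hA'_def, Set.indicator_of_notMem hmem]
      rw [this]; exact IsSelfAdjoint.zero 𝔸
  have hA'41 : ∀ j, j ≤ m → ∀ y τ, SideTouches (Ω j) y τ →
      W y τ = cfgExp η A' y τ ∧ ‖A' y τ‖ ≤ α₂ * ((L : ℝ) ^ j * η)⁻¹ := by
    intro j hj y τ hs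
    obtain ⟨hAA, -, hWe⟩ := hsock j hj y τ hs
    exact ⟨hWe, by rw [hAA]; exact (hWA j hj (y, τ) hs).2⟩
  -- global bound `‖A′‖ ≤ α₂η⁻¹`
  have hA'glob : ∀ y τ, ‖A' y τ‖ ≤ α₂ * η⁻¹ := by
    intro y τ
    by_cases hmem : (y, τ) ∈ M
    · obtain ⟨j, hj, hs⟩ := hmem
      have hLj : (1 : ℝ) ≤ (L : ℝ) ^ j := one_le_pow₀ hLr
      calc ‖A' y τ‖ ≤ α₂ * ((L : ℝ) ^ j * η)⁻¹ := (hA'41 j hj y τ hs).2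
        _ = α₂ * η⁻¹ * ((L : ℝ) ^ j)⁻¹ := by rw [mul_inv]; ring
        _ ≤ α₂ * η⁻¹ * 1 := by
            apply mul_le_mul_of_nonneg_left (inv_le_one_of_one_le₀ hLj) (by positivity)
        _ = α₂ * η⁻¹ := mul_one _
    · have : A' y τ = 0 := by simp only [hA'_def, Set.indicator_of_notMem hmem]
      rw [this, norm_zero]; positivity
  -- the in-edge (1.59) and the (1.42) clause for `A′`
  obtain ⟨h59a, h59g⟩ := H59Dβ m hm1 hmk u W A' hu huS hW h129 hLan hA'sa hA'41 hA'0
  have h42 := H42 m hm1 hmk u W A' hu hW h129 hLan hA'sa hA'41 hA'0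
  -- (1.40) for `U₀` and for `e^{iηA′}U₀` at the `m` levels
  have h40₀ : InAk L m η α₀ Ω U₀ := fun j hj => h33 j (hj.trans hmk)
  have h40W : InAk L m η α₀ Ω (mulCfg W U₀) := by
    have h1 : InAk L m η α₀ Ω (mulCfg U' U₀) := fun j hj => h34 j (hj.trans hmk)
    have hui : ∀ x, u⁻¹ x ∈ U1 𝔸 := fun x => unitaryUnits_le_U1 ((unitaryUnits 𝔸).inv_mem (hu x))
    rw [mulCfg_eq_gaugeAct_of_mgauge_eq hW]
    exact (B8Ineq132.inAk_gaugeAct_iff L m η α₀ Ω hui _).2 h1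
  have h40₁ : InAk L m η α₀ Ω (mulCfg (expCfg (iEta η A')) U₀) := by
    refine (inAk_congr_of_sideTouches L m η α₀ (V := mulCfg W U₀) fun j hj y τ hs => ?_).1 h40W
    show W y τ * U₀ y τ = expCfg (iEta η A') y τ * U₀ y τ
    rw [(hA'41 j hj y τ hs).1, expCfg_iEta_eq_cfgExp]
  -- boundedness of the two weighted families and the gradient datum
  have hBa : Bdd L m η (-(1 : ℝ)) (fun j (b : Site d × Fin d) => SideTouches (Ω j) b.1 b.2) fun b => A' b.1 b.2 := by
    have e1 : (-(1 : ℝ)) = -((1 : ℕ) : ℝ) := by norm_num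
    rw [e1]
    refine B8ScaledSupNorm.bdd_of_forall (c := α₂) fun j hj b hb => ?_
    have hs : 0 < (L : ℝ) ^ j * η := B8ScaledSupNorm.scale_pos hL1 hη j
    rw [B8ScaledSupNorm.weight_neg_natCast L η 1 j, pow_one]
    calc (L : ℝ) ^ j * η * ‖A' b.1 b.2‖ ≤ (L : ℝ) ^ j * η * (α₂ * ((L : ℝ) ^ j * η)⁻¹) :=
        mul_le_mul_of_nonneg_left (hA'41 j hj b.1 b.2 hb).2 hs.le
      _ = α₂ := by field_simp
  have hU₀1 : ∀ x κ, U₀ x κ ∈ U1 𝔸 := fun x κ => unitaryUnits_le_U1 (hU₀ x κ)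
  have hgrad : ∀ (y : Site d) (κ τ : Fin d), ‖covDerivFwd η U₀ κ (fun z => A' z τ) y‖ ≤ 2 * α₂ * η⁻¹ * η⁻¹ := by
    intro y κ τ
    unfold covDerivFwd
    rw [norm_smul, norm_inv, Real.norm_eq_abs, abs_of_pos hη]
    have h1 : ‖conjR (U₀ y κ) (A' (y + e κ) τ) - A' y τ‖ ≤ α₂ * η⁻¹ + α₂ * η⁻¹ := by
      calc ‖conjR (U₀ y κ) (A' (y + e κ) τ) - A' y τ‖
          ≤ ‖conjR (U₀ y κ) (A' (y + e κ) τ)‖ + ‖A' y τ‖ := norm_sub_le _ _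
        _ ≤ α₂ * η⁻¹ + α₂ * η⁻¹ := by
            rw [B8Ineq132.norm_conjR (hU₀1 y κ)]
            exact add_le_add (hA'glob _ _) (hA'glob _ _)
    calc η⁻¹ * ‖conjR (U₀ y κ) (A' (y + e κ) τ) - A' y τ‖ ≤ η⁻¹ * (α₂ * η⁻¹ + α₂ * η⁻¹) :=
        mul_le_mul_of_nonneg_left h1 (by positivity)
      _ = 2 * α₂ * η⁻¹ * η⁻¹ := by ring
  have hBg : Bdd L m η (-(2 : ℝ)) (fun j (t : Fin d × Fin d × Site d) => SideTouches (Ω j) t.2.2 t.2.1)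
      (fun t => covDerivFwd η U₀ t.1 (fun z => A' z t.2.1) t.2.2) := by
    have e2 : (-(2 : ℝ)) = -((2 : ℕ) : ℝ) := by norm_num
    rw [e2]
    refine B8ScaledSupNorm.bdd_of_forall (c := 2 * α₂ * ((L : ℝ) ^ m) ^ 2) fun j hj t _ => ?_
    rw [B8ScaledSupNorm.weight_neg_natCast L η 2 j]
    have hLjm : (L : ℝ) ^ j ≤ (L : ℝ) ^ m := pow_le_pow_right₀ hLr hj
    have hLj0 : (0 : ℝ) ≤ (L : ℝ) ^ j := by positivity
    calc ((L : ℝ) ^ j * η) ^ 2 * ‖covDerivFwd η U₀ t.1 (fun z => A' z t.2.1) t.2.2‖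
        ≤ ((L : ℝ) ^ j * η) ^ 2 * (2 * α₂ * η⁻¹ * η⁻¹) := mul_le_mul_of_nonneg_left (hgrad _ _ _) (by positivity)
      _ = 2 * α₂ * ((L : ℝ) ^ j) ^ 2 := by field_simp
      _ ≤ 2 * α₂ * ((L : ℝ) ^ m) ^ 2 := by gcongr
  set g : ℝ := msup L m η (-(2 : ℝ)) (fun j (t : Fin d × Fin d × Site d) => SideTouches (Ω j) t.2.2 t.2.1)
      (fun t => covDerivFwd η U₀ t.1 (fun z => A' z t.2.1) t.2.2) with hg_def
  have hg0 : 0 ≤ g := B8ScaledSupNorm.msup_nonneg L m hη.le _ _ _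
  have hg : ∀ j, j ≤ m → ∀ (y : Site d) (κ τ : Fin d), SideTouches (Ω j) y τ →
      ((L : ℝ) ^ j * η) ^ 2 * ‖covDerivFwd η U₀ κ (fun z => A' z τ) y‖ ≤ g := by
    intro j hj y κ τ hs
    have h := B8ScaledSupNorm.weight_mul_norm_le_msup hBg hj (i := (κ, τ, y)) hs
    have hw : weight L η (-(2 : ℝ)) j = ((L : ℝ) ^ j * η) ^ 2 := by
      have e2 : (-(2 : ℝ)) = -((2 : ℕ) : ℝ) := by norm_num
      rw [e2, B8ScaledSupNorm.weight_neg_natCast L η 2 j]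
    rw [hw] at h
    exact h
  -- `u = 1` AT BOTH END-POINTS OF A SIDE OF `Ω₀` NOT FULLY INSIDE `Ω₀` (outer end-points: support of `u`; an inner end-point with a neighbour
  -- outside is a boundary-layer site, in `Λs m 0` by `hlay`, where (1.29)₀ pins `u = 1`), so `W = U′` there and `η‖A′‖ = ‖log U′‖ ≤ 2‖U′ − 1‖ ≤ 2a`
  have he1 : ∀ (b : Site d × Fin d) (i : Fin d), b.1 i - 1 ≤ (b.1 + e b.2) i ∧ (b.1 + e b.2) i ≤ b.1 i + 1 := by
    intro b i
    simp only [Pi.add_apply, e_apply]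
    split_ifs <;> constructor <;> omega
  have he2 : ∀ (b : Site d × Fin d) (i : Fin d), (b.1 + e b.2) i - 1 ≤ b.1 i ∧ b.1 i ≤ (b.1 + e b.2) i + 1 := by
    intro b i
    simp only [Pi.add_apply, e_apply]
    split_ifs <;> constructor <;> omega
  have hu1 : ∀ b : Site d × Fin d, ¬ (b.1 ∈ Ω 0 ∧ b.1 + e b.2 ∈ Ω 0) → u b.1 = 1 ∧ u (b.1 + e b.2) = 1 := by
    intro b hnb
    refine ⟨?_, ?_⟩
    · by_cases h : b.1 ∈ Ω 0
      · exact Units.val_eq_one.mp (B8Eq119TwistedAxialRec.restr129Z_level_zero h129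
          (hlay m hm1 hmk b.1 (b.1 + e b.2) h (fun h' => hnb ⟨h, h'⟩) (he1 b)))
      · exact huS _ h
    · by_cases h : b.1 + e b.2 ∈ Ω 0
      · exact Units.val_eq_one.mp (B8Eq119TwistedAxialRec.restr129Z_level_zero h129
          (hlay m hm1 hmk (b.1 + e b.2) b.1 h (fun h' => hnb ⟨h', h⟩) (he2 b)))
      · exact huS _ h
  have hcol : ∀ b : Site d × Fin d, SideTouches (Ω 0) b.1 b.2 → ¬ (b.1 ∈ Ω 0 ∧ b.1 + e b.2 ∈ Ω 0) → η * ‖A' b.1 b.2‖ ≤ 2 * a := by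
    intro b hsd hnb
    obtain ⟨hx, hxe⟩ := hu1 b hnb
    -- `W_b = U′_b`
    have hWb : W b.1 b.2 = U' b.1 b.2 := by
      have h := congrFun (congrFun hW b.1) b.2
      rw [mgauge_apply, hx, hxe, one_mul] at h
      simpa using h
    -- `A′_b = (1/iη) log W_b`
    have hmem : (b.1, b.2) ∈ M := ⟨0, Nat.zero_le _, hsd⟩
    have hA'b : A' b.1 b.2 = η⁻¹ • ((I⁻¹ : ℂ) • mlog ((W b.1 b.2 : 𝔸ˣ) : 𝔸)) := by
      simp only [hA'_def, Set.indicator_of_mem hmem]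
    have hU'1 : ‖((U' b.1 b.2 : 𝔸ˣ) : 𝔸) - 1‖ ≤ 1 / 2 := (h66 b hsd).trans (by linarith only [ha])
    rw [hA'b, hWb, norm_smul, norm_smul, norm_inv, norm_inv, Complex.norm_I, inv_one, one_mul, Real.norm_eq_abs,
      abs_of_pos hη, ← mul_assoc, mul_inv_cancel₀ hη.ne', one_mul]
    exact (MatrixLog.norm_mlog_le_two_mul hU'1).trans (by linarith only [h66 b hsd])
  -- THE EXTERIOR-COLLAR TERM `Φ₀(A′) ≤ 2a` (outer sides) and its window
  set Φ₀ : ℝ := msup L m η (-(1 : ℝ)) (fun j (b : Site d × Fin d) => j = 0 ∧ SideTouches (Ω 0) b.1 b.2 ∧ ¬ BondTouches (Ω 0) b.1 b.2)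
      (fun b => A' b.1 b.2) with hΦ₀_def
  have hΦ₀ : Φ₀ ≤ 2 * a := by
    refine B8ScaledSupNorm.msup_le (by linarith only [ha0]) fun j hj b hb => ?_
    obtain ⟨rfl, hsd, hnb⟩ := hb
    have e1 : (-(1 : ℝ)) = -((1 : ℕ) : ℝ) := by norm_num
    rw [e1, B8ScaledSupNorm.weight_neg_natCast L η 1 0, pow_one, pow_zero, one_mul]
    exact hcol b hsd fun h => hnb (Or.inl h.1)
  have hΦ₀0 : 0 ≤ Φ₀ := B8ScaledSupNorm.msup_nonneg L m hη.le _ _ _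
  have hβ : Bbd * Φ₀ + Bbd * Φ₀ ≤ ((d : ℝ) * L - 1) * B₀ * (α₀ + α₁) := by
    have h1 := mul_le_mul_of_nonneg_left hΦ₀ hBbd
    linarith only [h1, hbdry]
  -- PROPOSITION 3 at `m` levels for `A′`: (1.55) (`eq155_norm_kLevel_hermitian`), «|B₁|β < 2dLα₁ + C₂α₂²» — on the constraint bonds by (1.42) + (1.37)
  -- (`norm_B1_lt_kLevel`), on a level-0 CROSSING bond `Q₀ = 1` and the term is `η‖A′(b)‖ ≤ 2a ≤ 2dLα₁` (`hcol`, `haα`) — then the bootstrap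
  -- (`apriori_160_bdry`) and the slack of (1.60) ⇒ (1.62) absorbing the collar allowance (`apriori_162_bdry`)
  have h₀ : ∀ y κ, U₀ y κ ∈ U1 𝔸 := fun y κ => unitaryUnits_le_U1 (hU₀ y κ)
  have h55 := B8Eq155KLevelLocal.eq155_norm_kLevel_hermitian hη hL1 h₀ hA'sa hα₀.le hα₂ h16 hd5 hg0 h40₀ h40₁
    (fun j hj y τ hs => (hA'41 j hj y τ hs).2) hg
  have h41'' : ∀ j, j ≤ m → ∀ x μ, BondTouches (Ω j) x μ → ‖A' x μ‖ ≤ α₂ * ((L : ℝ) ^ j * η)⁻¹ :=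
    fun j hj x μ hb => B8Prop3KLevel.bound_of_sideTouches hd2 (fun y τ hs => (hA'41 j hj y τ hs).2) x μ hb
  have hd' : (1 : ℝ) ≤ d := by exact_mod_cast (le_trans (by norm_num) hd2)
  have hdL : (1 : ℝ) ≤ (d : ℝ) * L := one_le_mul_of_one_le_of_one_le hd' hLr
  have hC0 : 0 ≤ (1 + 2 * gZ d L) * (2 * (131072 * ((d : ℝ) + 1) ^ 2) * (KZ d L) ^ 2) * Real.exp (4 * cZ d * ((L : ℝ) ^ 2 * α₀)) * (L : ℝ) ^ 2 * α₂ ^ 2 := by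
    unfold gZ
    positivity
  haveI : Nontrivial (Fin d) := Fin.nontrivial_iff_two_le.mpr hd2
  obtain ⟨ha', hg', -, -⟩ := B8Prop3KLevelBdry.apriori_160_bdry (L := (L : ℝ)) (B₀ := B₀) (α₁ := α₁)
    (C₂ := (1 + 2 * gZ d L) * (2 * (131072 * ((d : ℝ) + 1) ^ 2) * (KZ d L) ^ 2) * Real.exp (4 * cZ d * ((L : ℝ) ^ 2 * α₀)) * (L : ℝ) ^ 2)
    (Nat.cast_nonneg d) hB₀ hα₂ hg0 h55
    (by
      refine B8Eq155JBound.wsup_le (fun p => ?_) (by positivity)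
      obtain ⟨⟨j, b⟩, hj, hc | ⟨hj0, hcr⟩⟩ := p
      · have hj' : j ≤ m := hj
        have hc' : b ∈ Λb m j := hc
        show 1 * ‖linCovIterZ L U₀ (iEta η A') j b.1 b.2‖ ≤ _
        rw [one_mul]
        exact (norm_B1_lt_kLevel_γ hη hLs hs (le_trans (by norm_num) hd2) (avgClosedZ_unitaryUnits d L) U₀ hU₀ hα₀ hα3 hα4 A' hα₂ hsmall hc₃
          (hbox m hmk) h40₀ h41'' h42 hj' hc').le
      · have hj0' : j = 0 := hj0
        subst hj0'
        have hbt' : BondTouches (Ω 0) b.1 b.2 := hcr.1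
        have hnb' : ¬ (b.1 ∈ Ω 0 ∧ b.1 + e b.2 ∈ Ω 0) := hcr.2
        show 1 * ‖linCovIterZ L U₀ (iEta η A') 0 b.1 b.2‖ ≤ _
        rw [one_mul, B7SectEFLinearisationRec.linCovIterZ_zero, B8Eq154Local.norm_iEta_apply hη.le]
        obtain ⟨κ, hκ⟩ := exists_ne b.2
        have hsd : SideTouches (Ω 0) b.1 b.2 := B8Eq140Level.sideTouches_of_bondTouches hκ hbt'
        have h1 : 2 * a ≤ 2 * d * L * α₁ := by linarith only [haα]
        linarith only [hcol b hsd hnb', h1, hC0])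
    h59a h59g h59a h59a hside h50
  set R₀ := B₀ * (4 * α₀ + 4 * d * L * α₁ + 2 * α₂ ^ 2 + 20 * d * α₀ * α₂
      + 2 * ((1 + 2 * gZ d L) * (2 * (131072 * ((d : ℝ) + 1) ^ 2) * (KZ d L) ^ 2) * Real.exp (4 * cZ d * ((L : ℝ) ^ 2 * α₀)) * (L : ℝ) ^ 2)
        * α₂ ^ 2) with hR₀
  set R₁ := B₀ * (4 * α₀ + 4 * d * L * α₁ + 2 * α₂ ^ 2 + 20 * d * α₀ * α₂ + 2 * C₂ * α₂ ^ 2) with hR₁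
  have hR : R₀ ≤ R₁ := by
    rw [hR₀, hR₁]
    apply mul_le_mul_of_nonneg_left _ hB₀
    have hsq : 0 ≤ α₂ ^ 2 := sq_nonneg _
    have hCC := mul_le_mul_of_nonneg_right hC₂ hsq
    linarith only [hCC]
  have h162a : R₁ + (Bbd * Φ₀ + Bbd * Φ₀) ≤ 5 * d * L * B₀ * (α₀ + α₁) := by
    rw [hR₁]; exact B8Prop3KLevelBdry.apriori_162_bdry hB₀ hdL hα₀.le h61 hβ
  have ha : msup L m η (-(1 : ℝ)) (fun j (b : Site d × Fin d) => SideTouches (Ω j) b.1 b.2) (fun b => A' b.1 b.2)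
      ≤ 5 * d * L * B₀ * (α₀ + α₁) := by linarith only [ha', hR, h162a]
  -- pointwise on the socket bond, and back to `A`
  have hpt := B8ScaledSupNorm.norm_le_of_msup_le hL1 hη hBa ha hj₀ (i := b₀) hb₀
  rw [Real.rpow_neg_one] at hpt
  obtain ⟨hAA, -, -⟩ := hsock j₀ hj₀ b₀.1 b₀.2 hb₀
  rw [← hAA, hc]
  exact hpt



/-! ## §2 Theorem 4's existence clause at all levels with the support invariant, edition γ -/

/-- ★★ **THE EXISTENCE CLAUSE OF THEOREM 4 AT ALL LEVELS, GAUGE TRANSFORMATIONS CARRIED BY `Ω₀`, EDITION γ** — `B8Thm4KLevelBdryBeta.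
thm4_exists_all_levels_supp_landau138_bdryβ` with the datum class `Λb` a PARAMETER under print's law «box ⊂ Ω_{j−1}» and (1.35) guarded the same way; in-edge
`hP3_gaugeFixed_of_b9_γ`, (1.42) by `B8Eq142KLevelLocalGamma.H42_of_inAx_γ`; the linearisation windows at `(L²α₀, L·α₂)` (`hα3`, `hα4`, `h16γ`, `hsmall`, `hc₃`)
displayed next to Prop. 3's windows at `α₂` (`h16`, `hd5`, `hside`, `h50`, `h61`).  Feeds: at the cube member, `Λb := cubeLamBP` (dag-n05-c), the socket `H59Dβ`
by dag-n06-b's γ supplier.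
[cite: Balaban1985RegularSpaces, Thm 4 p.88, (1.29) p.81, (1.31) p.82, (1.38) p.82, (1.58)–(1.62) pp.86–87, (1.66) p.87, Prop. 5 (1.107)–(1.108) p.94] -/
theorem thm4_exists_all_levels_supp_landau138_γ (hd2 : 2 ≤ d) {η : ℝ} (hη : 0 < η) {L s : ℕ} (hLs : L = 2 * s + 1) (hs : 1 ≤ s) (k : ℕ)
    {U₀ U' : Site d → Fin d → 𝔸ˣ} (hU₀ : ∀ x κ, U₀ x κ ∈ unitaryUnits 𝔸) (hU' : ∀ x κ, U' x κ ∈ unitaryUnits 𝔸)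
    {α₀ α₁ α₄ B₀ cstar a : ℝ} (hα₀ : 0 < α₀) (hα₁ : 0 < α₁) (hα₄ : 0 ≤ α₄) (hB₀ : 0 ≤ B₀)
    (hc : cstar = 5 * d * L * B₀ * (α₀ + α₁))
    (hs₁ : α₄ ≤ 1 / 84) (hs₂ : L * cstar ≤ 1 / 12) (ha : a ≤ 1 / 4) (ha2 : 2 * a ≤ cstar)
    -- [3] Prop. 4's linearisation windows ONE LEVEL LOWER (edition γ)
    (hα3 : C0Z d * ((L : ℝ) ^ 2 * α₀) ≤ 1 / 3) (hα4 : 4 * ((L : ℝ) ^ 2 * α₀) ≤ c2' d L)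
    (h16 : 16 * (2 * (L * cstar) + 8 * α₄) ≤ 1) (hd5 : 5 * (2 * (L * cstar) + 8 * α₄) * ((d : ℝ) - 1) ≤ 4)
    (hsmall : Real.exp (4 * cZ d * ((L : ℝ) ^ 2 * α₀))
      * (1 + 2 * (131072 * ((d : ℝ) + 1) ^ 2) * (KZ d L) ^ 2 * ((L : ℝ) * (2 * (L * cstar) + 8 * α₄))) ≤ 2)
    (hc₃ : KZ d L * ((L : ℝ) * (2 * (L * cstar) + 8 * α₄)) ≤ c3 d L) (hside : 36 * d * B₀ * (2 * (L * cstar) + 8 * α₄) ≤ 1 / 2)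
    (h50 : 50 * d * (2 * (L * cstar) + 8 * α₄) ≤ 1) (hsmall₁ : (d : ℝ) * L * α₁ ≤ 1 / 8)
    {Bbd : ℝ} (hBbd : 0 ≤ Bbd) (ha0 : 0 ≤ a) (hbdry : 4 * Bbd * a ≤ ((d : ℝ) * L - 1) * B₀ * (α₀ + α₁))
    {C₂ : ℝ} (hC₂ : (1 + 2 * gZ d L) * (2 * (131072 * ((d : ℝ) + 1) ^ 2) * (KZ d L) ^ 2) * Real.exp (4 * cZ d * ((L : ℝ) ^ 2 * α₀)) * (L : ℝ) ^ 2 ≤ C₂)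
    (h61 : 2 * (2 * (L * cstar) + 8 * α₄) ^ 2 + 20 * d * α₀ * (2 * (L * cstar) + 8 * α₄)
      + 2 * C₂ * (2 * (L * cstar) + 8 * α₄) ^ 2 ≤ α₀ + α₁)
    (Ω : ℕ → Set (Site d)) (hΩ : ∀ j, Ω (j + 1) ⊆ Ω j) (Λs : ℕ → ℕ → Set (Site d)) (Λb : ℕ → ℕ → Set (Site d × Fin d))
    -- PRINT's box law (edition γ): the locality box of a level-`j` datum bond lies in `Ω_{j−1}` ((1.31); level 0: `Ω₀`)
    (hbox : ∀ m, m ≤ k → ∀ j, j ≤ m → ∀ c ∈ Λb m j, ∀ x, InBox (fun i => (L : ℤ) ^ j * c.1 i - (ctrShift L j : ℤ)) (fun i => (L : ℤ) ^ j * c.1 i + (ctrShift L j : ℤ) + if i = c.2 then (L : ℤ) ^ j else 0) x → x ∈ Ω (j - 1))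
    (hclass : ∀ m, m ≤ k → ∀ j, j ≤ m → ∀ c ∈ Λb m j,
      (c.1 ∈ Λs m j ∧ c.1 + e c.2 ∈ Λs m j) ∨
      (∃ j', j = j' + 1 ∧ (∀ x, (L : ℤ) • c.1 - halfVec L ≤ x → x ≤ (L : ℤ) • c.1 + halfVec L → x ∈ Λs m j') ∧ c.1 + e c.2 ∈ Λs m j) ∨
      (∃ j', j = j' + 1 ∧ c.1 ∈ Λs m j ∧ (∀ x, (L : ℤ) • (c.1 + e c.2) - halfVec L ≤ x → x ≤ (L : ℤ) • (c.1 + e c.2) + halfVec L → x ∈ Λs m j')))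
    (h33 : InAk L k η α₀ Ω U₀) (h34 : InAk L k η α₀ Ω (mulCfg U' U₀))
    (hAx : ∀ m, m ≤ k → InAxZ L m (Λs m) U₀ (mulCfg U' U₀))
    (h135 : ∀ j, j ≤ k → ∀ (z : Site d) (μ : Fin d), (∀ x, InBox (fun i => (L : ℤ) ^ j * z i - (ctrShift L j : ℤ)) (fun i => (L : ℤ) ^ j * z i + (ctrShift L j : ℤ) + if i = μ then (L : ℤ) ^ j else 0) x → x ∈ Ω (j - 1)) →
      ‖(avgIterZ L (mulCfg U' U₀) j z μ : 𝔸) - (avgIterZ L U₀ j z μ : 𝔸)‖ ≤ α₁)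
    (h66 : ∀ b ∈ {b : Site d × Fin d | SideTouches (Ω 0) b.1 b.2}, ‖((U' b.1 b.2 : 𝔸ˣ) : 𝔸) - 1‖ ≤ a)
    (hlay : ∀ m, 1 ≤ m → m ≤ k → ∀ y z : Site d, y ∈ Ω 0 → z ∉ Ω 0 → (∀ i, y i - 1 ≤ z i ∧ z i ≤ y i + 1) → y ∈ Λs m 0)
    (haα : a ≤ (d : ℝ) * L * α₁)
    (hP5base : ∃ (v : Site d → 𝔸ˣ) (lam : Site d → 𝔸), (∀ x, v x ∈ unitaryUnits 𝔸) ∧ (∀ x, x ∉ Ω 0 → v x = 1) ∧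
        (∀ j, j ≤ 1 → ∀ b ∈ {b : Site d × Fin d | SideTouches (Ω j) b.1 b.2}, (v b.1 : 𝔸) = ((gaugeExp lam b.1 : 𝔸ˣ) : 𝔸) ∧
          (v (b.1 + e b.2) : 𝔸) = ((gaugeExp lam (b.1 + e b.2) : 𝔸ˣ) : 𝔸)) ∧
        (∀ j, j ≤ 1 → ∀ b ∈ {b : Site d × Fin d | SideTouches (Ω j) b.1 b.2},
          ‖lam b.1‖ ≤ α₄ ∧ ((L : ℝ) ^ j * η) * ‖covDerivFwd η U₀ b.2 lam b.1‖ ≤ α₄) ∧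
        IsLandau138WZ L 1 η (Ω 0) (Λs 1) U₀ (mgauge U₀ v⁻¹ U') ∧ Restr129Z L 1 (Λs 1) U₀ ((1 : Site d → 𝔸ˣ) * v))
    (hP5 : ∀ m, 1 ≤ m → m < k → ∀ (u₁ : Site d → 𝔸ˣ) (U₁ : Site d → Fin d → 𝔸ˣ) (A : Site d → Fin d → 𝔸),
      (∀ x, u₁ x ∈ unitaryUnits 𝔸) → (∀ x, x ∉ Ω 0 → u₁ x = 1) → mgauge U₀ u₁ U₁ = U' → Restr129Z L m (Λs m) U₀ u₁ →
      IsLandau138WZ L m η (Ω 0) (Λs m) U₀ U₁ →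
      (∀ j, j ≤ m → ∀ b ∈ {b : Site d × Fin d | SideTouches (Ω j) b.1 b.2},
        U₁ b.1 b.2 = cfgExp η A b.1 b.2 ∧ IsSelfAdjoint (A b.1 b.2) ∧ ‖A b.1 b.2‖ ≤ cstar * ((L : ℝ) ^ j * η)⁻¹) →
      ∃ (v : Site d → 𝔸ˣ) (lam : Site d → 𝔸), (∀ x, v x ∈ unitaryUnits 𝔸) ∧ (∀ x, x ∉ Ω 0 → v x = 1) ∧
        (∀ j, j ≤ m + 1 → ∀ b ∈ {b : Site d × Fin d | SideTouches (Ω j) b.1 b.2}, (v b.1 : 𝔸) = ((gaugeExp lam b.1 : 𝔸ˣ) : 𝔸) ∧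
          (v (b.1 + e b.2) : 𝔸) = ((gaugeExp lam (b.1 + e b.2) : 𝔸ˣ) : 𝔸)) ∧
        (∀ j, j ≤ m + 1 → ∀ b ∈ {b : Site d × Fin d | SideTouches (Ω j) b.1 b.2},
          ‖lam b.1‖ ≤ α₄ ∧ ((L : ℝ) ^ j * η) * ‖covDerivFwd η U₀ b.2 lam b.1‖ ≤ α₄) ∧
        IsLandau138WZ L (m + 1) η (Ω 0) (Λs (m + 1)) U₀ (mgauge U₀ v⁻¹ U₁) ∧ Restr129Z L (m + 1) (Λs (m + 1)) U₀ (u₁ * v))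
    (H59Dβ : ∀ m, 1 ≤ m → m ≤ k → ∀ (u : Site d → 𝔸ˣ) (W : Site d → Fin d → 𝔸ˣ) (A' : Site d → Fin d → 𝔸),
      (∀ x, u x ∈ unitaryUnits 𝔸) → (∀ x, x ∉ Ω 0 → u x = 1) → mgauge U₀ u W = U' → Restr129Z L m (Λs m) U₀ u →
      IsLandau138WZ L m η (Ω 0) (Λs m) U₀ W →
      (∀ y τ, IsSelfAdjoint (A' y τ)) →
      (∀ j, j ≤ m → ∀ y τ, SideTouches (Ω j) y τ →
        W y τ = cfgExp η A' y τ ∧ ‖A' y τ‖ ≤ (2 * (L * cstar) + 8 * α₄) * ((L : ℝ) ^ j * η)⁻¹) →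
      (∀ y τ, (∀ j, j ≤ m → ¬ SideTouches (Ω j) y τ) → A' y τ = 0) →
      msup L m η (-(1 : ℝ)) (fun j (b : Site d × Fin d) => SideTouches (Ω j) b.1 b.2) (fun b => A' b.1 b.2)
          ≤ B₀ * (bondNorm L m η (-(3 : ℝ)) Ω (fun x μ => Jcur η U₀ A' μ x)
            + wsup 1 (fun p : {p : ℕ × (Site d × Fin d) // p.1 ≤ m ∧ (p.2 ∈ Λb m p.1 ∨ (p.1 = 0 ∧ CrossB (Ω 0) p.2))} =>
                linCovIterZ L U₀ (iEta η A') p.1.1 p.1.2.1 p.1.2.2))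
            + Bbd * msup L m η (-(1 : ℝ)) (fun j (b : Site d × Fin d) => j = 0 ∧ SideTouches (Ω 0) b.1 b.2 ∧ ¬ BondTouches (Ω 0) b.1 b.2)
                (fun b => A' b.1 b.2) ∧
        msup L m η (-(2 : ℝ)) (fun j (t : Fin d × Fin d × Site d) => SideTouches (Ω j) t.2.2 t.2.1)
            (fun t => covDerivFwd η U₀ t.1 (fun z => A' z t.2.1) t.2.2)
          ≤ B₀ * (bondNorm L m η (-(3 : ℝ)) Ω (fun x μ => Jcur η U₀ A' μ x)
            + wsup 1 (fun p : {p : ℕ × (Site d × Fin d) // p.1 ≤ m ∧ (p.2 ∈ Λb m p.1 ∨ (p.1 = 0 ∧ CrossB (Ω 0) p.2))} =>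
                linCovIterZ L U₀ (iEta η A') p.1.1 p.1.2.1 p.1.2.2))
            + Bbd * msup L m η (-(1 : ℝ)) (fun j (b : Site d × Fin d) => j = 0 ∧ SideTouches (Ω 0) b.1 b.2 ∧ ¬ BondTouches (Ω 0) b.1 b.2)
                (fun b => A' b.1 b.2)) :
    ∀ m, m ≤ k → ∃ u : Site d → 𝔸ˣ, (∀ x, u x ∈ unitaryUnits 𝔸) ∧ (∀ x, x ∉ Ω 0 → u x = 1) ∧ Restr129Z L m (Λs m) U₀ u ∧
      ∃ W : Site d → Fin d → 𝔸ˣ, mgauge U₀ u W = U' ∧ (1 ≤ m → IsLandau138WZ L m η (Ω 0) (Λs m) U₀ W) ∧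
        ∃ A : Site d → Fin d → 𝔸, ∀ j, j ≤ m → ∀ b ∈ {b : Site d × Fin d | SideTouches (Ω j) b.1 b.2},
          W b.1 b.2 = cfgExp η A b.1 b.2 ∧ IsSelfAdjoint (A b.1 b.2) ∧ ‖A b.1 b.2‖ ≤ cstar * ((L : ℝ) ^ j * η)⁻¹ := by
  have hL1 : 1 ≤ L := by omega
  have hcstar : 0 ≤ cstar := by rw [hc]; positivity
  have hα₂ : 0 ≤ 2 * (L * cstar) + 8 * α₄ := by positivity
  have hE : ∀ j, {b : Site d × Fin d | SideTouches (Ω (j + 1)) b.1 b.2} ⊆ {b : Site d × Fin d | SideTouches (Ω j) b.1 b.2} :=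
    fun j b hb => B8Eq140Level.sideTouches_mono (hΩ j) hb
  exact B8Thm4SupportLocalBdryRec.thm4_exists_all_levels_supp_bdry hL1 hη (Ω 0) hU₀ hU' hcstar hα₄ hs₁ hs₂ ha ha2
    (fun j => {b : Site d × Fin d | SideTouches (Ω j) b.1 b.2}) hE h66 Λs (fun m W => IsLandau138WZ L m η (Ω 0) (Λs m) U₀ W)
    hP5base hP5
    (hP3_gaugeFixed_of_b9_γ hd2 hη hLs hs k hU₀ hU' hα₀ hα₁.le hα₄ hB₀ hc hα3 hα4 h16 hd5 hsmall hc₃ hside h50 hC₂ h61 hBbd ha0 ha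
      hbdry Ω Λs Λb hbox h33 h34 h66 hlay haα (fun m W => IsLandau138WZ L m η (Ω 0) (Λs m) U₀ W)
      (B8Eq142KLevelLocalGammaRec.H42_of_inAx_γ hd2 hη hLs hs k hU₀ hα₀ hα₁ hα₂ hα3 hα4 hsmall hc₃ hsmall₁ Ω hΩ Λs Λb hbox hclass h33 h34
        hAx h135 (fun m W => IsLandau138WZ L m η (Ω 0) (Λs m) U₀ W))
      H59Dβ)

#print axioms thm4_exists_all_levels_supp_landau138_γ

end Literature.MathematicalPhysics.QuantumFieldTheory.Balaban1983to89.B8Thm4KLevelGammaRec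

end
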